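import Summits.BirchSwinnertonDyer.BirchSwinnertonDyer.Theorems.SchneiderFreeControlAtoms
import Summits.BirchSwinnertonDyer.Rank1Residual.X11b.BDPRouteLocalKernelExact
import Summits.BirchSwinnertonDyer.Rank1Residual.X11b.BDPRouteLocalKernelAtPPadic
import Summits.BirchSwinnertonDyer.Rank1Residual.Iwasawa.LocalTowerKernelCardLeTorsion
import HarnessLib

/-!
# Crux `AnticycControlAdditive` (route `SchneiderFreeAdditiveX3`, items stmt-BirchSwinnertonDyer-19178 /
# 19295): the strict-place kernel on the `t_p ≥ 1` half — `#ker r_𝔭 = #E(ℚ_p)[p^∞]` from Fin_v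

Seat `bsd-schneider-door-c4`, gen 2 (cell `bsd-schneider-ideate`). On the `t_p ≥ 1` half of the crux
(frames with `E(ℚ_p)[p] ≠ 0`: the `(3, e = 2)` pairs with local `3`-torsion) gen 0's torsion-robust count
`additiveControlOnTreeAt_of_torsAtoms` carries the strict place's local kernel as `#ker r_𝔭 = p^t` and
the base count with the exponent `… + g − t`; the typed control EQUALITY needs `t = t_p := ord_p #E(ℚ_p)[p^∞]`
EXACTLY (the tree has `≤` unconditionally, `natCard_localKer_le_natCard_primaryComponent_padic`). This
file proves the equality from Fin_v — the finiteness of `E(K_{∞,w})[p^∞] = E(K̄)[p^∞]^{D_𝔭 ⊓ ker κ}`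
(`SchneiderFreeControlAtoms.LocalTowerTorsionFiniteAt`) — and the non-splitting of `𝔭` in `K_∞`:

* `natCard_fixedPoints_decomp_eq_natCard_primaryComponent` — Galois descent is an EQUALITY:
  `#E(K̄)[p^∞]^{D_v} = #E(K_v)[p^∞]` (the tree's `≤` plus the injection `E(K_v)[p^∞] ↪ E(K̄)[p^∞]^{D_v}`
  by algebraicity of torsion, `exists_pointsMapOfEmb_eq_of_nsmul_eq_zero`);
* `natCard_localKer_eq_natCard_fixedPoints_of_finite` — Greenberg's Lemma 3.3 at a place NOT split
  completely in `K_∞` with `B_v = E(K_{∞,w})[p^∞]` FINITE: `#ker r_v = #B_v/(γ_v − 1)B_v = #B_v^{γ_v} =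
  #E(K̄)[p^∞]^{D_v}` (the tree's exact transport `natCard_localKer_eq_natCard_quotient_range_decompSubOne` +
  `#coker = #ker` for an endomorphism of a finite group);
* **`natCard_localKer_eq_natCard_primaryComponent_padic_of_finite`** — for `E/ℚ`, a degree-one `𝔭 ∣ p`
  of `K`, any `ℤ_p`-extension `κ` in which `𝔭` does not split completely, and Fin_v at `𝔭`:
  `#ker r_𝔭 = #E(ℚ_p)[p^∞]`, i.e. the exponent `t` of gen 0's glue IS `t_p`. Conversely WITHOUT Fin_v the
  kernel is strictly smaller whenever `B_𝔭` has a divisible line (snake lemma), so Fin_v is exactly what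
  the `t_p ≥ 1` half of the crux needs at the strict place (memo FINDING-door-c4-g2 §4).

Proofs only; no `Prop` fact minted; closes nothing by itself; BSD is not proved by any of this.

References: [GreenbergLNM1716] §3 Lemma 3.3 and its proof (p. 87), p. 90; [JetchevSkinnerWan2017] §3.3
Prop. 3.3.4 Case 3(b) (arXiv:1512.06894 p. 13); [SilvermanAEC2009] III.6.4(b), VIII.§1.
-/

noncomputable section

open scoped Classical

open WeierstrassCurve NumberField IsDedekindDomain Field Literature.NumberTheory.EllipticCurves
  Literature.NumberTheory.EllipticCurves.GreenbergSelmer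
  Literature.NumberTheory.GaloisRepresentations
  Summit.BirchSwinnertonDyer.Rank1Residual
  Summit.BirchSwinnertonDyer.Rank1Residual.X11b
  Summit.BirchSwinnertonDyer.Rank1Residual.X11b.AcSelmer
  Summit.BirchSwinnertonDyer.BirchSwinnertonDyer.Theorems.SchneiderFreeControlAtoms

set_option linter.dupNamespace false

namespace Summit.BirchSwinnertonDyer.BirchSwinnertonDyer.Theorems.SchneiderFreeAdditiveX3

universe u

/-! ## §1. Galois descent is an equality: `#E(K̄)[p^∞]^{D_v} = #E(K_v)[p^∞]` -/

section Descent

variable {K : Type u} [Field K] [NumberField K] (W : WeierstrassCurve K) [W.IsElliptic] (p : ℕ)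
  [Fact p.Prime] (v : HeightOneSpectrum (𝓞 K))

/-- **`E(K_v)[p^∞] ↪ E(K̄)[p^∞]^{D_v}`**: a `p`-power torsion point of `E(K_v)`, mapped into `E(K̄_v)`,
comes from a torsion point of `E(K̄)` (algebraicity of torsion), which is fixed by the decomposition
group `D_v` (the image of `Γ_{K_v}`; images of `K_v`-rational points are `Γ_{K_v}`-fixed).
[cite: SilvermanAEC2009, Cor. III.6.4(b) and VIII.§1] -/
theorem exists_fixedPoints_decomp_of_primaryComponent
    (R : AddCommGroup.primaryComponent (W.baseChange (v.adicCompletion K)).toAffine.Point p) :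
    ∃ m : FixedPoints.addSubgroup ↥(decomp v) (W.geomPrimaryTorsion p),
      pointsMapOfEmb W (closureEmb (K := K) (v.adicCompletion K))
          ((m : W.geomPrimaryTorsion p) : W.geomPoints) =
        (show localPoints W (v.adicCompletion K) from
          Affine.Point.map (IsScalarTower.toAlgHom K (v.adicCompletion K)
            (AlgebraicClosure (v.adicCompletion K))) (R : (W.baseChange (v.adicCompletion K)).toAffine.Point)) := by
  have hp : p.Prime := Fact.out
  haveI : CharZero (v.adicCompletion K) :=
    charZero_of_injective_algebraMap (algebraMap K (v.adicCompletion K)).injective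
  let ι₀ := closureEmb (K := K) (v.adicCompletion K)
  let X : localPoints W (v.adicCompletion K) :=
    show localPoints W (v.adicCompletion K) from
      Affine.Point.map (IsScalarTower.toAlgHom K (v.adicCompletion K)
        (AlgebraicClosure (v.adicCompletion K))) (R : (W.baseChange (v.adicCompletion K)).toAffine.Point)
  obtain ⟨n, hn⟩ := (AddCommGroup.mem_primaryComponent).mp R.2
  have hpX : p ^ n • X = 0 := by
    have h := congrArg (Affine.Point.map (W' := W)
      (IsScalarTower.toAlgHom K (v.adicCompletion K) (AlgebraicClosure (v.adicCompletion K)))) hn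
    rw [map_nsmul, map_zero] at h
    exact h
  obtain ⟨P, hpP, hPX⟩ :=
    exists_pointsMapOfEmb_eq_of_nsmul_eq_zero W ι₀ (pow_ne_zero n hp.ne_zero) hpX
  have hPmem : P ∈ W.geomPrimaryTorsion p := (AddCommGroup.mem_primaryComponent).mpr ⟨n, hpP⟩
  have hXfix : ∀ τ : absoluteGaloisGroup (v.adicCompletion K), τ • X = X := fun τ ↦
    Iwasawa.smul_map_toAlgHom_eq W τ (R : (W.baseChange (v.adicCompletion K)).toAffine.Point)
  have hfix : ∀ d : ↥(decomp v), d • (⟨P, hPmem⟩ : W.geomPrimaryTorsion p) = ⟨P, hPmem⟩ := by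
    intro d
    obtain ⟨τ, hτ⟩ := (mem_decomp_iff v _).mp d.2
    apply Subtype.ext
    show (d : absoluteGaloisGroup K) • P = P
    rw [← hτ]
    apply pointsMapOfEmb_injective W ι₀
    show pointsMapOfEmb W ι₀ (resGalOfEmb ι₀ τ • P) = _
    rw [pointsMapOfEmb_smul, hPX]
    exact hXfix τ
  exact ⟨⟨⟨P, hPmem⟩, (FixedPoints.mem_addSubgroup _ _ _).mpr hfix⟩, hPX⟩

/-- **`#E(K̄)[p^∞]^{D_v} = #E(K_v)[p^∞]`** when the latter is finite: the tree's descent inequality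
`natCard_fixedPoints_decomp_le_natCard_primaryComponent` and the injection of
`exists_fixedPoints_decomp_of_primaryComponent`. [cite: GreenbergLNM1716, §3 Lemma 3.3 (proof, p. 87)]
[cite: SilvermanAEC2009, Cor. III.6.4(b) and VIII.§1] -/
theorem natCard_fixedPoints_decomp_eq_natCard_primaryComponent
    [Finite (AddCommGroup.primaryComponent (W.baseChange (v.adicCompletion K)).toAffine.Point p)] :
    Nat.card (FixedPoints.addSubgroup ↥(decomp v) (W.geomPrimaryTorsion p)) =
      Nat.card (AddCommGroup.primaryComponent (W.baseChange (v.adicCompletion K)).toAffine.Point p) := by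
  obtain ⟨hfinF, hle⟩ := natCard_fixedPoints_decomp_le_natCard_primaryComponent W p v
  haveI := hfinF
  refine le_antisymm hle ?_
  choose ψ hψ using exists_fixedPoints_decomp_of_primaryComponent W p v
  refine Nat.card_le_card_of_injective ψ fun R R' h ↦ ?_
  have h1 := hψ R
  rw [h, hψ R'] at h1
  apply Subtype.ext
  exact WeierstrassCurve.Affine.Point.map_injective (W' := W)
    (IsScalarTower.toAlgHom K (v.adicCompletion K) (AlgebraicClosure (v.adicCompletion K))) h1.symm

end Descent

/-! ## §2. `#ker r_v = #E(K̄)[p^∞]^{D_v}` when `B_v` is finite and `v` does not split in `K_∞` -/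

section Kernel

variable {K : Type u} [Field K] [NumberField K] (W : WeierstrassCurve K) [W.IsElliptic] (p : ℕ)
  [Fact p.Prime] (κ : ZpExtension K p) (v : HeightOneSpectrum (𝓞 K))

omit [W.IsElliptic] in
/-- **Greenberg's Lemma 3.3 as an EQUALITY at a place with finite `B_v`.** For a `ℤ_p`-extension `κ`
and a finite place `v` NOT split completely in `K_∞` (`¬ D_v ≤ ker κ`), if
`B_v = E(K̄)[p^∞]^{ker κ ⊓ D_v} = E(K_{∞,w})[p^∞]` is finite then
`#ker (H¹(K_v, E[p^∞]) → H¹(K_{∞,w}, E[p^∞])) = #E(K̄)[p^∞]^{D_v}`: the tree's exact transport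
`#ker r_v = #B_v/(γ_v − 1)B_v` (`natCard_localKer_eq_natCard_quotient_range_decompSubOne`), then
`#B/(γ − 1)B = #ker(γ − 1|_B)` for the FINITE group `B`, and `ker(γ_v − 1|_{B_v}) = E(K̄)[p^∞]^{D_v}`
(`γ_v` and `ker κ ⊓ D_v` generate `D_v` topologically, `smul_eq_of_decompSubOne_eq_zero`).
[cite: GreenbergLNM1716, §3 Lemma 3.3 (proof, p. 87) and p. 90] -/
theorem natCard_localKer_eq_natCard_fixedPoints_of_finite
    [hB : Finite (FixedPoints.addSubgroup ↥(κ.kerSubgroup ⊓ decomp v) (W.geomPrimaryTorsion p))]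
    (hv : ¬ decomp v ≤ κ.kerSubgroup) :
    Nat.card (localKer κ.kerSubgroup (W.geomPrimaryTorsion p) v) =
      Nat.card (FixedPoints.addSubgroup ↥(decomp v) (W.geomPrimaryTorsion p)) := by
  have hprim : IsPrimaryTorsion p (W.geomPrimaryTorsion p) := fun Q ↦
    (AddCommGroup.mem_primaryComponent.mp Q.2).imp fun k hk ↦
      Subtype.ext (by rw [AddSubmonoidClass.coe_nsmul, hk, ZeroMemClass.coe_zero])
  obtain ⟨g, hgen⟩ := exists_mem_decomp_generate κ v
  have hgD : (g : absoluteGaloisGroup K) ∈ decomp v := (Subgroup.mem_inf.mp g.2).2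
  set B := FixedPoints.addSubgroup ↥(κ.kerSubgroup ⊓ decomp v) (W.geomPrimaryTorsion p)
  set φ : B →+ B := decompSubOne κ (W.geomPrimaryTorsion p) (g : absoluteGaloisGroup K) hgD with hφ
  -- exact transport
  have htr := natCard_localKer_eq_natCard_quotient_range_decompSubOne κ (W.geomPrimaryTorsion p)
    (W.continuous_smul_geomPrimaryTorsion p) hprim hv hgen
  rw [htr]
  -- `#B/φ(B) = #ker φ` for the finite group `B`
  have hcard : Nat.card (B ⧸ φ.range) = Nat.card φ.ker := by
    have h1 := AddSubgroup.card_eq_card_quotient_mul_card_addSubgroup φ.range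
    have h2 := AddSubgroup.card_eq_card_quotient_mul_card_addSubgroup φ.ker
    rw [Nat.card_congr (QuotientAddGroup.quotientKerEquivRange φ).toEquiv, mul_comm] at h2
    rw [h2] at h1
    exact (Nat.eq_of_mul_eq_mul_right Nat.card_pos h1).symm
  rw [hcard]
  -- `ker φ ≃ E(K̄)[p^∞]^{D_v}`
  let j : φ.ker → FixedPoints.addSubgroup ↥(decomp v) (W.geomPrimaryTorsion p) := fun b ↦
    ⟨((b : B) : W.geomPrimaryTorsion p), fun x ↦
      smul_eq_of_decompSubOne_eq_zero W p κ v hgen (b : B) ((AddMonoidHom.mem_ker).mp b.2) x x.2⟩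
  have hj : Function.Injective j := by
    intro a b hab
    apply Subtype.ext; apply Subtype.ext
    exact congrArg (fun z : FixedPoints.addSubgroup ↥(decomp v) (W.geomPrimaryTorsion p) ↦
      (z : W.geomPrimaryTorsion p)) hab
  have hjs : Function.Surjective j := by
    intro m
    have hmB : (m : W.geomPrimaryTorsion p) ∈ B :=
      (FixedPoints.mem_addSubgroup _ _ _).mpr fun x ↦ m.2 ⟨x.1, (Subgroup.mem_inf.mp x.2).2⟩
    have hker : (⟨(m : W.geomPrimaryTorsion p), hmB⟩ : B) ∈ φ.ker := by
      rw [AddMonoidHom.mem_ker]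
      apply Subtype.ext
      rw [hφ, coe_decompSubOne_apply, ZeroMemClass.coe_zero, sub_eq_zero]
      exact m.2 ⟨(g : absoluteGaloisGroup K), hgD⟩
    exact ⟨⟨_, hker⟩, Subtype.ext rfl⟩
  exact Nat.card_congr (Equiv.ofBijective j ⟨hj, hjs⟩)

end Kernel

/-! ## §3. `E/ℚ`, a degree-one `𝔭 ∣ p`: `#ker r_𝔭 = #E(ℚ_p)[p^∞]` from Fin_v -/

section Padic

variable (W : WeierstrassCurve ℚ) [W.IsElliptic] [W.IsGloballyMinimal] (p : ℕ) [Fact p.Prime]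
  {K : Type} [Field K] [NumberField K] (κ : ZpExtension K p)

/-- **The strict place's kernel on the `t_p ≥ 1` half: `#ker r_𝔭 = #E(ℚ_p)[p^∞] = p^{t_p}`** for the
globally minimal `E/ℚ`, any number field `K`, a degree-one prime `𝔭 ∣ p` of `K` (`K_𝔭 ≃ ℚ_p`), any
`ℤ_p`-extension `κ` in which `𝔭` does NOT split completely, GIVEN Fin_v
(`LocalTowerTorsionFiniteAt (E_K) p κ 𝔭`: `E(K_{∞,w})[p^∞]` finite). So the exponent `t` of gen 0's
torsion-robust glue `additiveControlOnTreeAt_of_torsAtoms` IS `t_p` under Fin_v; JSW17 Prop. 3.3.4 Case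
3(b) ("`#ker r_v = #H⁰(K_v, W)`") on the constructed objects, with (sst)/(HT) replaced by Fin_v itself.
[cite: JetchevSkinnerWan2017, Prop. 3.3.4 Case 3(b) (arXiv:1512.06894 p. 13)]
[cite: GreenbergLNM1716, §3 Lemma 3.3 (p. 87) and p. 90] -/
theorem natCard_localKer_eq_natCard_primaryComponent_padic_of_finite
    (𝔭 : HeightOneSpectrum (𝓞 K)) (h𝔭 : ((p : ℕ) : 𝓞 K) ∈ 𝔭.asIdeal)
    (he : 𝔭.asIdeal.ramificationIdx (𝓞 ℚ) = 1) (hf : 𝔭.asIdeal.inertiaDeg (𝓞 ℚ) = 1)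
    (hFin : LocalTowerTorsionFiniteAt (W.baseChange K) p κ 𝔭) (hv : ¬ decomp 𝔭 ≤ κ.kerSubgroup) :
    Nat.card (localKer κ.kerSubgroup ((W.baseChange K).geomPrimaryTorsion p) 𝔭) =
      Nat.card (AddCommGroup.primaryComponent (W.baseChange ℚ_[p]).toAffine.Point p) := by
  haveI hEK : (W.baseChange K).IsElliptic := by rw [baseChange]; infer_instance
  -- Fin_v, with the two orders of the intersection
  haveI hfin1 : Finite (FixedPoints.addSubgroup ↥(decomp 𝔭 ⊓ κ.kerSubgroup)
      ((W.baseChange K).geomPrimaryTorsion p)) := hFin.to_subtype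
  haveI : Finite (FixedPoints.addSubgroup ↥(κ.kerSubgroup ⊓ decomp 𝔭)
      ((W.baseChange K).geomPrimaryTorsion p)) := by
    refine Finite.of_injective (fun b ↦ (⟨(b : (W.baseChange K).geomPrimaryTorsion p),
      (FixedPoints.mem_addSubgroup _ _ _).mpr fun x ↦
        b.2 ⟨x.1, Subgroup.mem_inf.mpr ⟨(Subgroup.mem_inf.mp x.2).2, (Subgroup.mem_inf.mp x.2).1⟩⟩⟩ :
      FixedPoints.addSubgroup ↥(decomp 𝔭 ⊓ κ.kerSubgroup) ((W.baseChange K).geomPrimaryTorsion p)))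
      fun a b hab ↦ ?_
    apply Subtype.ext
    exact congrArg (fun z : FixedPoints.addSubgroup ↥(decomp 𝔭 ⊓ κ.kerSubgroup)
      ((W.baseChange K).geomPrimaryTorsion p) ↦ (z : (W.baseChange K).geomPrimaryTorsion p)) hab
  -- `E(K_𝔭)[p^∞] ≃ E(ℚ_p)[p^∞]`, finite
  obtain ⟨hfinv, hcardv⟩ := finite_and_natCard_primaryComponent_adicCompletion_eq_padic W p 𝔭 h𝔭 he hf
  have hW : (W.baseChange K).baseChange (𝔭.adicCompletion K) = W.baseChange (𝔭.adicCompletion K) :=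
    W.map_baseChange (algebraMap K (𝔭.adicCompletion K)).toRatAlgHom
  haveI : Finite (AddCommGroup.primaryComponent
      ((W.baseChange K).baseChange (𝔭.adicCompletion K)).toAffine.Point p) := hfinv
  rw [natCard_localKer_eq_natCard_fixedPoints_of_finite (W.baseChange K) p κ 𝔭 hv,
    natCard_fixedPoints_decomp_eq_natCard_primaryComponent (W.baseChange K) p 𝔭, hcardv]

/-- **Numeric form**: under Fin_v and non-splitting, `#ker r_𝔭 = p^{t_p}` with
`p^{t_p} = #E(ℚ_p)[p^∞]`. [cite: GreenbergLNM1716, §3 Lemma 3.3 (p. 87)] -/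
theorem natCard_localKer_eq_pow_of_finite
    (𝔭 : HeightOneSpectrum (𝓞 K)) (h𝔭 : ((p : ℕ) : 𝓞 K) ∈ 𝔭.asIdeal)
    (he : 𝔭.asIdeal.ramificationIdx (𝓞 ℚ) = 1) (hf : 𝔭.asIdeal.inertiaDeg (𝓞 ℚ) = 1)
    (hFin : LocalTowerTorsionFiniteAt (W.baseChange K) p κ 𝔭) (hv : ¬ decomp 𝔭 ≤ κ.kerSubgroup)
    {t : ℕ} (ht : Nat.card (AddCommGroup.primaryComponent (W.baseChange ℚ_[p]).toAffine.Point p) = p ^ t) :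
    Nat.card (localKer κ.kerSubgroup ((W.baseChange K).geomPrimaryTorsion p) 𝔭) = p ^ t := by
  rw [natCard_localKer_eq_natCard_primaryComponent_padic_of_finite W p κ 𝔭 h𝔭 he hf hFin hv, ht]

end Padic

end Summit.BirchSwinnertonDyer.BirchSwinnertonDyer.Theorems.SchneiderFreeAdditiveX3

end
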